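import Summits.Ventures.PercRepro.C025ProfileThinRowLevel

/-!
# THE PARALLEL-PAIR STEP OF THE HALL FORM AT EVERY LEVEL (night-3 g17)
**`hallIneq_of_parallel_level`** (`q u`, `q + 1 ≤ u`): for non-loops `x ≠ y` with `y ∈ cl{x}`, `HallIneq (M ＼ {y}) (q+1) (u+1)` and
`HallIneq ((M ／ {x}) ＼ {y}) q u` give `HallIneq M (q+1) (u+1)` — the proof of `hallIneq_of_parallel` (`C025ProfileThinHallStepsC`, the
level `u = q + 2`) verbatim with `u + 1` for the level and `price_rooted_le_level` (`C025ProfileThinRowLevel`) for the rooted price.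
No `def`, no `instance`, no notation.  Axioms: standard.
-/
open scoped Matroid
namespace PercRepro
open Set Finset ThmH Staged
namespace ThinGirth
variable {α : Type} [DecidableEq α] {M : Matroid α} [M.Finite]

/-- **The parallel-pair step of the Hall form** (a Hall Theorem F): for non-loops `x ≠ y` with `y ∈ cl{x}`, the Hall form
`(H⁺_{q+1,q+2})` of `M` follows from `(H⁺_{q+1,q+2})` of `M ＼ {y}` and `(H⁺_{q,q+1})` of `(M ／ {x}) ＼ {y}`. -/
theorem hallIneq_of_parallel_level {x y : α} (hx : M.Indep {x}) (hy : M.Indep {y}) (hxy : x ≠ y)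
    (hpar : y ∈ M.closure {x}) (q u : ℕ) (hqu : q + 1 ≤ u)
    (h1 : Profile.HallIneq (M ＼ {y}) (q + 1) (u + 1))
    (h2 : Profile.HallIneq ((M ／ {x}) ＼ {y}) q u) :
    Profile.HallIneq M (q + 1) (u + 1) := by
  intro 𝒜 h𝒜
  have hxE : x ∈ M.E := hx.subset_ground (mem_singleton x)
  have hyE : y ∈ M.E := hy.subset_ground (mem_singleton y)
  have hxG : x ∉ gr ((M ／ {x}) ＼ {y}) := notMem_gr_contract_delete_left x y
  have hyG : y ∉ gr ((M ／ {x}) ＼ {y}) := notMem_gr_contract_delete_right x y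
  have hG : gr M = insert y (insert x (gr ((M ／ {x}) ＼ {y}))) := gr_eq_insert_insert hxE hyE hxy
  have hG' : gr (M ＼ {y}) = insert x (gr ((M ／ {x}) ＼ {y})) := gr_delete_eq_insert hxE hxy
  have hGsub : gr ((M ／ {x}) ＼ {y}) ⊆ gr M := by
    rw [hG]
    exact (Finset.subset_insert _ _).trans (Finset.subset_insert _ _)
  have hG'sub : gr (M ＼ {y}) ⊆ gr M := by
    rw [gr_delete]
    exact Finset.erase_subset y _
  have hGG' : gr ((M ／ {x}) ＼ {y}) ⊆ gr (M ＼ {y}) := by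
    rw [hG']
    exact Finset.subset_insert _ _
  have hyG' : y ∉ gr (M ＼ {y}) := by
    rw [gr_delete]
    exact Finset.notMem_erase y _
  -- a subset of `gr M` avoiding `x` and `y` lies in `gr N`; a subset of `gr M'` avoiding `x` lies in `gr N`
  have hsubN : ∀ B ⊆ gr M, x ∉ B → y ∉ B → B ⊆ gr ((M ／ {x}) ＼ {y}) := by
    intro B hB hxB hyB z hz
    have := hB hz
    rw [hG, Finset.mem_insert, Finset.mem_insert] at this
    rcases this with h | h | h
    · exact absurd (h ▸ hz) hyB
    · exact absurd (h ▸ hz) hxB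
    · exact h
  have hsubN' : ∀ S ⊆ gr (M ＼ {y}), x ∉ S → S ⊆ gr ((M ／ {x}) ＼ {y}) := by
    intro S hS hxS z hz
    have := hS hz
    rw [hG', Finset.mem_insert] at this
    rcases this with h | h
    · exact absurd (h ▸ hz) hxS
    · exact h
  have hprice0 : ∀ T ⊆ gr ((M ／ {x}) ＼ {y}),
      Profile.price M (q + 1) (u + 1) T = Profile.price (M ＼ {y}) (q + 1) (u + 1) T := by
    intro T hT
    apply price_eq_of_eRk_eq
    rw [par_sdiff_T hxE hyE hxy hT, par_sdiff_delete_T hxE hxy hT,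
      par_eRk_insert_y_insert_x hx hpar Finset.sdiff_subset, par_eRk_insert_x hx hxy Finset.sdiff_subset]
  have hpricexy : ∀ T ⊆ gr ((M ／ {x}) ＼ {y}),
      Profile.price M (q + 1) (u + 1) (insert y (insert x T)) =
        Profile.price (M ＼ {y}) (q + 1) (u + 1) (insert x T) := by
    intro T hT
    apply price_eq_of_eRk_eq
    rw [par_sdiff_insert_y_insert_x hxE hyE hxy hT, par_sdiff_delete_insert_x hxE hxy hT,
      par_eRk_T Finset.sdiff_subset]
  have hpricex : ∀ T ⊆ gr ((M ／ {x}) ＼ {y}),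
      Profile.price M (q + 1) (u + 1) (insert x T) ≤ Profile.price ((M ／ {x}) ＼ {y}) q u T := by
    intro T hT
    apply price_rooted_le_level q u hqu
    rw [par_sdiff_insert_x hxE hyE hxy hT, par_eRk_insert_y hx hy hxy hpar Finset.sdiff_subset,
      par_eRk_insert_x hx hxy Finset.sdiff_subset, par_eRk_insert_x_eq_contract hx hxy Finset.sdiff_subset]
  have hpricey : ∀ T ⊆ gr ((M ／ {x}) ＼ {y}),
      Profile.price M (q + 1) (u + 1) (insert y T) ≤ Profile.price ((M ／ {x}) ＼ {y}) q u T := by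
    intro T hT
    apply price_rooted_le_level q u hqu
    rw [par_sdiff_insert_y hxE hyE hxy hT, par_eRk_insert_x hx hxy Finset.sdiff_subset,
      par_eRk_insert_x_eq_contract hx hxy Finset.sdiff_subset]
  -- rank facts in `rkN`-free form
  have hrkx : ∀ T ⊆ gr ((M ／ {x}) ＼ {y}),
      M.eRk ((insert x T : Finset α) : Set α) = ((M ／ {x}) ＼ {y}).eRk (T : Set α) + 1 := by
    intro T hT
    rw [par_eRk_insert_x hx hxy hT, par_eRk_insert_x_eq_contract hx hxy hT]
  have hrky : ∀ T ⊆ gr ((M ／ {x}) ＼ {y}),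
      M.eRk ((insert y T : Finset α) : Set α) = ((M ／ {x}) ＼ {y}).eRk (T : Set α) + 1 := by
    intro T hT
    rw [par_eRk_insert_y hx hy hxy hpar hT, hrkx T hT]
  have hrkxy : ∀ T ⊆ gr ((M ／ {x}) ＼ {y}),
      M.eRk ((insert y (insert x T) : Finset α) : Set α) = (M ＼ {y}).eRk ((insert x T : Finset α) : Set α) := by
    intro T hT
    rw [par_eRk_insert_y_insert_x hx hpar hT, par_eRk_insert_x hx hxy hT]
  -- the four parts of `𝒜`
  set 𝒜₀ := (𝒜.filter (fun B => ¬ y ∈ B)).filter (fun B => ¬ x ∈ B) with h𝒜₀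
  set 𝒜ₓ := (𝒜.filter (fun B => ¬ y ∈ B)).filter (fun B => x ∈ B) with h𝒜ₓ
  set 𝒜ᵧ := (𝒜.filter (fun B => y ∈ B)).filter (fun B => ¬ x ∈ B) with h𝒜ᵧ
  set 𝒜ₓᵧ := (𝒜.filter (fun B => y ∈ B)).filter (fun B => x ∈ B) with h𝒜ₓᵧ
  have hmem₀ : ∀ B, B ∈ 𝒜₀ ↔ (B ∈ 𝒜 ∧ ¬ y ∈ B) ∧ ¬ x ∈ B := by
    intro B; rw [h𝒜₀, Finset.mem_filter, Finset.mem_filter]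
  have hmemₓ : ∀ B, B ∈ 𝒜ₓ ↔ (B ∈ 𝒜 ∧ ¬ y ∈ B) ∧ x ∈ B := by
    intro B; rw [h𝒜ₓ, Finset.mem_filter, Finset.mem_filter]
  have hmemᵧ : ∀ B, B ∈ 𝒜ᵧ ↔ (B ∈ 𝒜 ∧ y ∈ B) ∧ ¬ x ∈ B := by
    intro B; rw [h𝒜ᵧ, Finset.mem_filter, Finset.mem_filter]
  have hmemₓᵧ : ∀ B, B ∈ 𝒜ₓᵧ ↔ (B ∈ 𝒜 ∧ y ∈ B) ∧ x ∈ B := by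
    intro B; rw [h𝒜ₓᵧ, Finset.mem_filter, Finset.mem_filter]
  have hA : ∀ B ∈ 𝒜, B ⊆ gr M ∧ M.eRk (B : Set α) = ((q + 1 : ℕ) : ℕ∞) := fun B hB => Profile.mem_Rq.1 (h𝒜 hB)
  -- cores
  have hcore₀ : ∀ B ∈ 𝒜₀, B ⊆ gr ((M ／ {x}) ＼ {y}) := by
    intro B hB
    rw [hmem₀] at hB
    exact hsubN B (hA B hB.1.1).1 hB.2 hB.1.2
  have hcoreₓ : ∀ B ∈ 𝒜ₓ, B.erase x ⊆ gr ((M ／ {x}) ＼ {y}) ∧ B = insert x (B.erase x) := by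
    intro B hB
    rw [hmemₓ] at hB
    exact ⟨hsubN _ ((Finset.erase_subset x B).trans (hA B hB.1.1).1) (Finset.notMem_erase x B)
      (fun h => hB.1.2 (Finset.mem_erase.1 h).2), (Finset.insert_erase hB.2).symm⟩
  have hcoreᵧ : ∀ B ∈ 𝒜ᵧ, B.erase y ⊆ gr ((M ／ {x}) ＼ {y}) ∧ B = insert y (B.erase y) := by
    intro B hB
    rw [hmemᵧ] at hB
    exact ⟨hsubN _ ((Finset.erase_subset y B).trans (hA B hB.1.1).1)
      (fun h => hB.2 (Finset.mem_erase.1 h).2) (Finset.notMem_erase y B), (Finset.insert_erase hB.1.2).symm⟩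
  have hcoreₓᵧ : ∀ B ∈ 𝒜ₓᵧ, (B.erase y).erase x ⊆ gr ((M ／ {x}) ＼ {y}) ∧
      B.erase y = insert x ((B.erase y).erase x) ∧ B = insert y (B.erase y) := by
    intro B hB
    rw [hmemₓᵧ] at hB
    refine ⟨hsubN _ ((Finset.erase_subset x _).trans ((Finset.erase_subset y B).trans (hA B hB.1.1).1))
      (Finset.notMem_erase x _) (fun h => Finset.notMem_erase y B (Finset.mem_erase.1 h).2), ?_, ?_⟩
    · exact (Finset.insert_erase (Finset.mem_erase.2 ⟨hxy, hB.2⟩)).symm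
    · exact (Finset.insert_erase hB.1.2).symm
  -- the three families
  set ℬ := 𝒜₀ ∪ 𝒜ₓᵧ.image (fun B => B.erase y) with hℬ
  set 𝒞ₓ := 𝒜ₓ.image (fun B => B.erase x) with h𝒞ₓ
  set 𝒞ᵧ := 𝒜ᵧ.image (fun B => B.erase y) with h𝒞ᵧ
  have hℬRq : ℬ ⊆ Profile.Rq (M ＼ {y}) (q + 1) := by
    intro B' hB'
    rw [hℬ, Finset.mem_union, Finset.mem_image] at hB'
    rw [Profile.mem_Rq]
    rcases hB' with hB' | ⟨B, hB, rfl⟩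
    · have hc := hcore₀ B' hB'
      rw [hmem₀] at hB'
      exact ⟨hc.trans hGG', by rw [← par_eRk_T hc]; exact (hA B' hB'.1.1).2⟩
    · obtain ⟨hc, he, hB'⟩ := hcoreₓᵧ B hB
      rw [hmemₓᵧ] at hB
      refine ⟨?_, ?_⟩
      · rw [he]
        exact Finset.insert_subset (by rw [hG']; exact Finset.mem_insert_self x _) (hc.trans hGG')
      · rw [he, ← hrkxy _ hc, ← he, ← hB']
        exact (hA B hB.1.1).2
  have h𝒞ₓRq : 𝒞ₓ ⊆ Profile.Rq ((M ／ {x}) ＼ {y}) q := by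
    intro C hC
    rw [h𝒞ₓ, Finset.mem_image] at hC
    obtain ⟨B, hB, rfl⟩ := hC
    obtain ⟨hc, he⟩ := hcoreₓ B hB
    rw [hmemₓ] at hB
    rw [Profile.mem_Rq]
    refine ⟨hc, ?_⟩
    rw [← eRk_add_one_eq_iff, ← hrkx _ hc, ← he]
    exact (hA B hB.1.1).2
  have h𝒞ᵧRq : 𝒞ᵧ ⊆ Profile.Rq ((M ／ {x}) ＼ {y}) q := by
    intro C hC
    rw [h𝒞ᵧ, Finset.mem_image] at hC
    obtain ⟨B, hB, rfl⟩ := hC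
    obtain ⟨hc, he⟩ := hcoreᵧ B hB
    rw [hmemᵧ] at hB
    rw [Profile.mem_Rq]
    refine ⟨hc, ?_⟩
    rw [← eRk_add_one_eq_iff, ← hrky _ hc, ← he]
    exact (hA B hB.1.1).2
  -- injectivity of the erasures
  have hinjₓ : Set.InjOn (fun B : Finset α => B.erase x) (𝒜ₓ : Set (Finset α)) := by
    intro B₁ hB₁ B₂ hB₂ hEq
    simp only at hEq
    rw [(hcoreₓ B₁ hB₁).2, (hcoreₓ B₂ hB₂).2, hEq]
  have hinjᵧ : Set.InjOn (fun B : Finset α => B.erase y) (𝒜ᵧ : Set (Finset α)) := by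
    intro B₁ hB₁ B₂ hB₂ hEq
    simp only at hEq
    rw [(hcoreᵧ B₁ hB₁).2, (hcoreᵧ B₂ hB₂).2, hEq]
  have hinjₓᵧ : Set.InjOn (fun B : Finset α => B.erase y) (𝒜ₓᵧ : Set (Finset α)) := by
    intro B₁ hB₁ B₂ hB₂ hEq
    simp only at hEq
    rw [(hcoreₓᵧ B₁ hB₁).2.2, (hcoreₓᵧ B₂ hB₂).2.2, hEq]
  have hdisjℬ : Disjoint 𝒜₀ (𝒜ₓᵧ.image (fun B => B.erase y)) := by
    rw [Finset.disjoint_left]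
    intro B hB hB'
    rw [Finset.mem_image] at hB'
    obtain ⟨B₁, hB₁, hEq⟩ := hB'
    rw [hmem₀] at hB
    apply hB.2
    rw [← hEq]
    exact Finset.mem_erase.2 ⟨hxy, ((hmemₓᵧ B₁).1 hB₁).2⟩
  -- the total price
  have hsum : ∑ B ∈ 𝒜, Profile.price M (q + 1) (u + 1) B =
      ∑ B ∈ ℬ, Profile.price (M ＼ {y}) (q + 1) (u + 1) B +
        ∑ B ∈ 𝒜ₓ, Profile.price M (q + 1) (u + 1) B + ∑ B ∈ 𝒜ᵧ, Profile.price M (q + 1) (u + 1) B := by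
    rw [hℬ, Finset.sum_union hdisjℬ, Finset.sum_image hinjₓᵧ]
    rw [← Finset.sum_filter_add_sum_filter_not 𝒜 (fun B => y ∈ B),
      ← Finset.sum_filter_add_sum_filter_not (𝒜.filter (fun B => y ∈ B)) (fun B => x ∈ B),
      ← Finset.sum_filter_add_sum_filter_not (𝒜.filter (fun B => ¬ y ∈ B)) (fun B => x ∈ B)]
    have e0 : ∑ B ∈ 𝒜₀, Profile.price M (q + 1) (u + 1) B =
        ∑ B ∈ 𝒜₀, Profile.price (M ＼ {y}) (q + 1) (u + 1) B :=
      Finset.sum_congr rfl (fun B hB => hprice0 B (hcore₀ B hB))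
    have exy : ∑ B ∈ 𝒜ₓᵧ, Profile.price M (q + 1) (u + 1) B =
        ∑ B ∈ 𝒜ₓᵧ, Profile.price (M ＼ {y}) (q + 1) (u + 1) (B.erase y) := by
      apply Finset.sum_congr rfl
      intro B hB
      obtain ⟨hc, he, hB'⟩ := hcoreₓᵧ B hB
      rw [he]
      conv_lhs => rw [hB', he]
      exact hpricexy _ hc
    rw [← h𝒜₀, ← h𝒜ₓ, ← h𝒜ᵧ, ← h𝒜ₓᵧ, e0, exy]
    ring
  -- the rooted sums are at most the sums of `N`
  have hrootx : ∑ B ∈ 𝒜ₓ, Profile.price M (q + 1) (u + 1) B ≤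
      ∑ C ∈ 𝒞ₓ, Profile.price ((M ／ {x}) ＼ {y}) q u C := by
    rw [h𝒞ₓ, Finset.sum_image hinjₓ]
    apply Finset.sum_le_sum
    intro B hB
    obtain ⟨hc, he⟩ := hcoreₓ B hB
    conv_lhs => rw [he]
    exact hpricex _ hc
  have hrooty : ∑ B ∈ 𝒜ᵧ, Profile.price M (q + 1) (u + 1) B ≤
      ∑ C ∈ 𝒞ᵧ, Profile.price ((M ／ {x}) ＼ {y}) q u C := by
    rw [h𝒞ᵧ, Finset.sum_image hinjᵧ]
    apply Finset.sum_le_sum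
    intro B hB
    obtain ⟨hc, he⟩ := hcoreᵧ B hB
    conv_lhs => rw [he]
    exact hpricey _ hc
  -- the four injections into the shadow of `𝒜`
  set J₁ := (Shadow.shadowLevel (M ＼ {y}) (u + 1) ℬ).filter (fun S => ¬ x ∈ S) with hJ₁
  set J₂ := ((Shadow.shadowLevel (M ＼ {y}) (u + 1) ℬ).filter (fun S => x ∈ S)).image (fun S => insert y S) with hJ₂
  set J₃ := (Shadow.shadowLevel ((M ／ {x}) ＼ {y}) u 𝒞ₓ).image (fun T => insert x T) with hJ₃
  set J₄ := (Shadow.shadowLevel ((M ／ {x}) ＼ {y}) u 𝒞ᵧ).image (fun T => insert y T) with hJ₄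
  have hJ₁sub : J₁ ⊆ Shadow.shadowLevel M (u + 1) 𝒜 := by
    intro S hS
    rw [hJ₁, Finset.mem_filter, mem_shadowLevel_iff] at hS
    obtain ⟨⟨⟨hSg, hSr⟩, B', hB', hB'S⟩, hxS⟩ := hS
    have hSN := hsubN' S hSg hxS
    rw [mem_shadowLevel_iff]
    refine ⟨⟨hSg.trans hG'sub, by rw [par_eRk_T hSN]; exact hSr⟩, ?_⟩
    rw [hℬ, Finset.mem_union, Finset.mem_image] at hB'
    rcases hB' with hB' | ⟨B, hB, rfl⟩
    · exact ⟨B', ((hmem₀ B').1 hB').1.1, hB'S⟩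
    · exfalso
      exact hxS (hB'S (Finset.mem_erase.2 ⟨hxy, ((hmemₓᵧ B).1 hB).2⟩))
  have hJ₂sub : J₂ ⊆ Shadow.shadowLevel M (u + 1) 𝒜 := by
    intro S hS
    rw [hJ₂, Finset.mem_image] at hS
    obtain ⟨S', hS', rfl⟩ := hS
    rw [Finset.mem_filter, mem_shadowLevel_iff] at hS'
    obtain ⟨⟨⟨hSg, hSr⟩, B', hB', hB'S⟩, hxS⟩ := hS'
    have hT : S'.erase x ⊆ gr ((M ／ {x}) ＼ {y}) :=
      hsubN' _ ((Finset.erase_subset x S').trans hSg) (Finset.notMem_erase x S')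
    have hS'e : S' = insert x (S'.erase x) := (Finset.insert_erase hxS).symm
    rw [mem_shadowLevel_iff]
    refine ⟨⟨Finset.insert_subset (mem_gr_of_mem_ground hyE) (hSg.trans hG'sub), ?_⟩, ?_⟩
    · rw [hS'e, hrkxy _ hT, ← hS'e]
      exact hSr
    · rw [hℬ, Finset.mem_union, Finset.mem_image] at hB'
      rcases hB' with hB' | ⟨B, hB, rfl⟩
      · exact ⟨B', ((hmem₀ B').1 hB').1.1, hB'S.trans (Finset.subset_insert y S')⟩
      · refine ⟨B, ((hmemₓᵧ B).1 hB).1.1, ?_⟩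
        rw [(hcoreₓᵧ B hB).2.2]
        exact Finset.insert_subset_insert y hB'S
  have hJ₃sub : J₃ ⊆ Shadow.shadowLevel M (u + 1) 𝒜 := by
    intro S hS
    rw [hJ₃, Finset.mem_image] at hS
    obtain ⟨T, hT, rfl⟩ := hS
    rw [mem_shadowLevel_iff] at hT ⊢
    obtain ⟨⟨hTg, hTr⟩, C, hC, hCT⟩ := hT
    refine ⟨⟨Finset.insert_subset (mem_gr_of_mem_ground hxE) (hTg.trans hGsub), ?_⟩, ?_⟩
    · rw [hrkx _ hTg, hTr]
      norm_cast
    · rw [h𝒞ₓ, Finset.mem_image] at hC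
      obtain ⟨B, hB, rfl⟩ := hC
      refine ⟨B, ((hmemₓ B).1 hB).1.1, ?_⟩
      rw [(hcoreₓ B hB).2]
      exact Finset.insert_subset_insert x hCT
  have hJ₄sub : J₄ ⊆ Shadow.shadowLevel M (u + 1) 𝒜 := by
    intro S hS
    rw [hJ₄, Finset.mem_image] at hS
    obtain ⟨T, hT, rfl⟩ := hS
    rw [mem_shadowLevel_iff] at hT ⊢
    obtain ⟨⟨hTg, hTr⟩, C, hC, hCT⟩ := hT
    refine ⟨⟨Finset.insert_subset (mem_gr_of_mem_ground hyE) (hTg.trans hGsub), ?_⟩, ?_⟩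
    · rw [hrky _ hTg, hTr]
      norm_cast
    · rw [h𝒞ᵧ, Finset.mem_image] at hC
      obtain ⟨B, hB, rfl⟩ := hC
      refine ⟨B, ((hmemᵧ B).1 hB).1.1, ?_⟩
      rw [(hcoreᵧ B hB).2]
      exact Finset.insert_subset_insert y hCT
  -- signatures of the four images by `x ∈ S`, `y ∈ S`
  have hsig₁ : ∀ S ∈ J₁, ¬ x ∈ S ∧ ¬ y ∈ S := by
    intro S hS
    rw [hJ₁, Finset.mem_filter, mem_shadowLevel_iff] at hS
    exact ⟨hS.2, fun h => hyG' (hS.1.1.1 h)⟩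
  have hsig₂ : ∀ S ∈ J₂, x ∈ S ∧ y ∈ S := by
    intro S hS
    rw [hJ₂, Finset.mem_image] at hS
    obtain ⟨S', hS', rfl⟩ := hS
    rw [Finset.mem_filter] at hS'
    exact ⟨Finset.mem_insert_of_mem hS'.2, Finset.mem_insert_self y S'⟩
  have hsig₃ : ∀ S ∈ J₃, x ∈ S ∧ ¬ y ∈ S := by
    intro S hS
    rw [hJ₃, Finset.mem_image] at hS
    obtain ⟨T, hT, rfl⟩ := hS
    rw [mem_shadowLevel_iff] at hT
    refine ⟨Finset.mem_insert_self x T, ?_⟩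
    rw [Finset.mem_insert]
    rintro (h | h)
    · exact hxy h.symm
    · exact hyG (hT.1.1 h)
  have hsig₄ : ∀ S ∈ J₄, ¬ x ∈ S ∧ y ∈ S := by
    intro S hS
    rw [hJ₄, Finset.mem_image] at hS
    obtain ⟨T, hT, rfl⟩ := hS
    rw [mem_shadowLevel_iff] at hT
    refine ⟨?_, Finset.mem_insert_self y T⟩
    rw [Finset.mem_insert]
    rintro (h | h)
    · exact hxy h
    · exact hxG (hT.1.1 h)
  have hd₁₂ : Disjoint J₁ J₂ := Finset.disjoint_left.2 (fun S h₁ h₂ => (hsig₁ S h₁).1 (hsig₂ S h₂).1)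
  have hd₁₃ : Disjoint J₁ J₃ := Finset.disjoint_left.2 (fun S h₁ h₃ => (hsig₁ S h₁).1 (hsig₃ S h₃).1)
  have hd₁₄ : Disjoint J₁ J₄ := Finset.disjoint_left.2 (fun S h₁ h₄ => (hsig₁ S h₁).2 (hsig₄ S h₄).2)
  have hd₂₃ : Disjoint J₂ J₃ := Finset.disjoint_left.2 (fun S h₂ h₃ => (hsig₃ S h₃).2 (hsig₂ S h₂).2)
  have hd₂₄ : Disjoint J₂ J₄ := Finset.disjoint_left.2 (fun S h₂ h₄ => (hsig₄ S h₄).1 (hsig₂ S h₂).1)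
  have hd₃₄ : Disjoint J₃ J₄ := Finset.disjoint_left.2 (fun S h₃ h₄ => (hsig₄ S h₄).1 (hsig₃ S h₃).1)
  -- cardinalities
  have hinj₂ : Set.InjOn (fun S : Finset α => insert y S)
      (((Shadow.shadowLevel (M ＼ {y}) (u + 1) ℬ).filter (fun S => x ∈ S)) : Set (Finset α)) := by
    intro S₁ hS₁ S₂ hS₂ hEq
    rw [Finset.mem_coe, Finset.mem_filter, mem_shadowLevel_iff] at hS₁ hS₂
    simp only at hEq
    rw [← Finset.erase_insert (fun h => hyG' (hS₁.1.1.1 h)), ← Finset.erase_insert (fun h => hyG' (hS₂.1.1.1 h)), hEq]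
  have hinj₃ : Set.InjOn (fun T : Finset α => insert x T)
      ((Shadow.shadowLevel ((M ／ {x}) ＼ {y}) u 𝒞ₓ) : Set (Finset α)) := by
    intro T₁ hT₁ T₂ hT₂ hEq
    rw [Finset.mem_coe, mem_shadowLevel_iff] at hT₁ hT₂
    simp only at hEq
    rw [← Finset.erase_insert (fun h => hxG (hT₁.1.1 h)), ← Finset.erase_insert (fun h => hxG (hT₂.1.1 h)), hEq]
  have hinj₄ : Set.InjOn (fun T : Finset α => insert y T)
      ((Shadow.shadowLevel ((M ／ {x}) ＼ {y}) u 𝒞ᵧ) : Set (Finset α)) := by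
    intro T₁ hT₁ T₂ hT₂ hEq
    rw [Finset.mem_coe, mem_shadowLevel_iff] at hT₁ hT₂
    simp only at hEq
    rw [← Finset.erase_insert (fun h => hyG (hT₁.1.1 h)), ← Finset.erase_insert (fun h => hyG (hT₂.1.1 h)), hEq]
  have hcardℬ : (Shadow.shadowLevel (M ＼ {y}) (u + 1) ℬ).card = J₁.card + J₂.card := by
    rw [hJ₂, Finset.card_image_of_injOn hinj₂, hJ₁, add_comm (Finset.card _)]
    exact (Finset.card_filter_add_card_filter_not _).symm
  have hcard₃ : (Shadow.shadowLevel ((M ／ {x}) ＼ {y}) u 𝒞ₓ).card = J₃.card := by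
    rw [hJ₃, Finset.card_image_of_injOn hinj₃]
  have hcard₄ : (Shadow.shadowLevel ((M ／ {x}) ＼ {y}) u 𝒞ᵧ).card = J₄.card := by
    rw [hJ₄, Finset.card_image_of_injOn hinj₄]
  have hunion : J₁.card + J₂.card + J₃.card + J₄.card ≤ (Shadow.shadowLevel M (u + 1) 𝒜).card := by
    have hsub : J₁ ∪ J₂ ∪ J₃ ∪ J₄ ⊆ Shadow.shadowLevel M (u + 1) 𝒜 :=
      Finset.union_subset (Finset.union_subset (Finset.union_subset hJ₁sub hJ₂sub) hJ₃sub) hJ₄sub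
    have h := Finset.card_le_card hsub
    rw [Finset.card_union_of_disjoint (Finset.disjoint_union_left.2 ⟨Finset.disjoint_union_left.2 ⟨hd₁₄, hd₂₄⟩, hd₃₄⟩),
      Finset.card_union_of_disjoint (Finset.disjoint_union_left.2 ⟨hd₁₃, hd₂₃⟩),
      Finset.card_union_of_disjoint hd₁₂] at h
    exact h
  -- assemble
  have hH1 := h1 ℬ hℬRq
  have hH2 := h2 𝒞ₓ h𝒞ₓRq
  have hH3 := h2 𝒞ᵧ h𝒞ᵧRq
  rw [hcardℬ] at hH1
  rw [hcard₃] at hH2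
  rw [hcard₄] at hH3
  have hunion' : (J₁.card : ℚ) + J₂.card + J₃.card + J₄.card ≤ ((Shadow.shadowLevel M (u + 1) 𝒜).card : ℚ) := by
    exact_mod_cast hunion
  push_cast at hH1
  linarith [hsum, hrootx, hrooty, hH1, hH2, hH3, hunion']

end ThinGirth
end PercRepro
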